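import Summits.AtomisticToContinuum.FouriersLaw.Theses.OddSectorIrreversibility

/-!
# Crux `BoundedResponseConverges` (stmt-AtomisticToContinuum-9141) — ideator 3 sketch (round 1)

First lemmas of three crux idea cards (planner-cruxidea-stmt-AtomisticToContinuum-9141-3-0):

* § 0  common vocabulary: the quantifier prefix of the crux (`Uniq`, `IsFamily`, `IsResponseSeq`,
        `IsProfile`) and the OHMIC BOND LEDGER `(N-1)/D_N = 2/γ + Σ_i r_{i,N}` (abstract form proved).
* § B  card `length-monotone-kirchhoff-mean`: `LengthMonotoneResponse`, `PositiveConductanceAtTwo`,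
        the real-analysis glue `real_glue` (PROVED) and the kernel-checked composition
        `boundedResponseConverges_of_monotone : LengthMonotoneResponse → PositiveConductanceAtTwo →
        BoundedResponseConverges` (PROVED, concludes the crux decl by name); `monotone_iff_intercept`
        (PROVED): monotonicity ⟺ non-negative secant intercept of the resistance-vs-length graph.
* § A  card `u-shaped-resistance-array`: the three signs `NonnegBondResistance` (m0),
        `UShapedResistance` (m1: bond resistance non-increasing from a contact to the middle bond),
        `LengthMonotoneBondResistance` (m2: at a fixed bond, non-increasing in the length), typed over the
        route objects; the abstract ORDER GLUE `OrderGlueStatement` ((m0)–(m2) + reflection + ledger +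
        bounded response ⇒ `(N−1)/R_N → 1/r∞ > 0`, pure order theory); plus the vocabulary
        `InteriorHomogeneity`, `VanishingContactJump`, `CesaroGlueStatement` shared with card C.
        (An earlier Liouville-type formulation `ZeroCurrentNoTilt` was WITHDRAWN before filing: at first
        order the even part `X + u_e` of the Green–Kubo gradient state is stationary, currentless and
        tilted, so no such rigidity holds in any momentum-reversal-symmetric class — see NOTES.md
        `## Barrier notes`.)
* § C  card `resistance-screening-prefix-universality`: `RightScreening` (typed over the route objects)
        and the de Bruijn–Erdős near-additivity lemma `NearAdditiveConverges` (statement).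
-/

noncomputable section

namespace Summit.AtomisticToContinuum.FouriersLaw.Cruxes.BoundedResponseConverges.Ideator3

open Filter Topology MeasureTheory
open Literature.MathematicalPhysics.KineticTheory.HeatConduction
open Summit.AtomisticToContinuum.FouriersLaw.Theses.OddSectorIrreversibility (BoundedResponseConverges)

/-! ### § 0 Vocabulary -/

/-- weak-NESS uniqueness for `pinnedChain ω₂ lam β γ` (the crux's first hypothesis, verbatim body). -/
def Uniq (ω₂ lam β γ : ℝ) : Prop :=
  ∀ (N : ℕ) (T_L T_R : ℝ), 0 < T_L → 0 < T_R →
    ∀ μ ν : Measure (PhaseSpace N),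
      (pinnedChain ω₂ lam β γ).IsSteadyState N T_L T_R μ →
      (pinnedChain ω₂ lam β γ).IsSteadyState N T_L T_R ν → μ = ν

/-- `μ` is a steady-state family (the crux's second hypothesis). -/
def IsFamily (ω₂ lam β γ : ℝ) (μ : (N : ℕ) → ℝ → ℝ → Measure (PhaseSpace N)) : Prop :=
  ∀ (N : ℕ) (T_L T_R : ℝ), 0 < T_L → 0 < T_R →
    (pinnedChain ω₂ lam β γ).IsSteadyState N T_L T_R (μ N T_L T_R)

/-- `D` is THE sequence of clause-(ii) response coefficients along `μ` at `T`. -/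
def IsResponseSeq (ω₂ lam β γ : ℝ) (μ : (N : ℕ) → ℝ → ℝ → Measure (PhaseSpace N)) (T : ℝ)
    (D : ℕ → ℝ) : Prop :=
  ∀ N : ℕ, Tendsto (fun δ : ℝ =>
    (pinnedChain ω₂ lam β γ).totalCurrent (μ N (T + δ / 2) (T - δ / 2)) / δ) (𝓝[≠] 0) (𝓝 (D N))

/-- `θ` is the first-order kinetic-temperature response profile at length `N` (pattern of
`TransferKernelPositivity.FiniteResponseProfile`). -/
def IsProfile (μ : (N : ℕ) → ℝ → ℝ → Measure (PhaseSpace N)) (T : ℝ) (N : ℕ)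
    (θ : Fin N → ℝ) : Prop :=
  ∀ i : Fin N, Tendsto (fun δ : ℝ =>
    ((∫ x, (x.2 i) ^ 2 ∂(μ N (T + δ / 2) (T - δ / 2))) - ∫ x, (x.2 i) ^ 2 ∂(μ N T T)) / δ)
    (𝓝[≠] 0) (𝓝 (θ i))

/-- local bond resistance `r_{i,N} = (θ_i − θ_{i+1}) / j_N`, `j_N = d/(N−1)` the per-bond current
response (junk if `i+1 ≥ N`). -/
def bondResistance (N : ℕ) (θ : Fin N → ℝ) (d : ℝ) (i : ℕ) : ℝ :=
  if h : i + 1 < N then (θ ⟨i, by omega⟩ - θ ⟨i + 1, h⟩) * (((N : ℝ) - 1) / d) else 0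

/-- OHMIC BOND LEDGER, abstract form (PROVED): from the two contact identities
`d = γ(N−1)(1/2 − θ₀) = γ(N−1)(θ_{N−1} + 1/2)` (route item `ContactIdentity`, stmt-12015) the
bath-to-bath resistance is `(N−1)/d = 2/γ + (θ₀ − θ_{N−1})·(N−1)/d`; the telescoped sum
`θ₀ − θ_{N−1} = Σ_i (θ_i − θ_{i+1})` then gives `R_N = 2/γ + Σ_i r_{i,N}`. -/
theorem ledger_abstract (γ : ℝ) (hγ : γ ≠ 0) (n d θ₀ θ₁ : ℝ) (hn : n ≠ 0) (hd : d ≠ 0)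
    (h0 : d = γ * n * (1 / 2 - θ₀)) (h1 : d = γ * n * (θ₁ + 1 / 2)) :
    n / d = 2 / γ + (θ₀ - θ₁) * (n / d) := by
  have hsum : 2 * d = γ * n * (1 + θ₁ - θ₀) := by linear_combination h0 + h1
  have h2 : 2 * d / (γ * n) * (n / d) = 2 / γ := by field_simp
  have e1 : (θ₀ - θ₁) * (γ * n) = γ * n - 2 * d := by linear_combination hsum
  have e2 : θ₀ - θ₁ = 1 - 2 * d / (γ * n) := by
    have hγn : γ * n ≠ 0 := mul_ne_zero hγ hn
    have := (eq_div_iff hγn).mpr e1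
    rw [this, sub_div, div_self hγn]
  calc n / d = 2 / γ + (1 - 2 * d / (γ * n)) * (n / d) := by rw [sub_mul, one_mul, h2]; ring
    _ = 2 / γ + (θ₀ - θ₁) * (n / d) := by rw [e2]

/-- OHMIC BOND LEDGER at the chain level (fixed `N`, provable from `ContactIdentity` + a Finset
telescope): `(N−1)/D_N = 2/γ + Σ_{i<N−1} r_{i,N}`. -/
def OhmicBondLedger : Prop :=
  ∀ ω₂ lam β γ : ℝ, 0 < ω₂ → 0 < lam → 0 < β → 0 < γ → Uniq ω₂ lam β γ →
    ∀ μ, IsFamily ω₂ lam β γ μ → ∀ T : ℝ, 0 < T → ∀ (N : ℕ), 2 ≤ N →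
      ∀ (θ : Fin N → ℝ) (d : ℝ), IsProfile μ T N θ →
        Tendsto (fun δ : ℝ => (pinnedChain ω₂ lam β γ).totalCurrent (μ N (T + δ / 2) (T - δ / 2)) / δ)
          (𝓝[≠] 0) (𝓝 d) → d ≠ 0 →
        ((N : ℝ) - 1) / d = 2 / γ + ∑ i ∈ Finset.range (N - 1), bondResistance N θ d i

/-! ### § B Card `length-monotone-kirchhoff-mean` -/

/-- (M) the Kirchhoff mean `D_N = (N−1)·G_N` is non-decreasing in the length from `N = 2` on. -/
def LengthMonotoneResponse : Prop :=
  ∀ ω₂ lam β γ : ℝ, 0 < ω₂ → 0 < lam → 0 < β → 0 < γ → Uniq ω₂ lam β γ →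
    ∀ μ, IsFamily ω₂ lam β γ μ → ∀ T : ℝ, 0 < T → ∀ D : ℕ → ℝ, IsResponseSeq ω₂ lam β γ μ T D →
      ∀ N : ℕ, 2 ≤ N → D N ≤ D (N + 1)

/-- (P₂) the two-site chain conducts: `D_2 > 0` (fixed-N positivity of the linear-response
conductance; `PositiveConductance` of FeketeSeriesLaw at the single length `N = 2`). -/
def PositiveConductanceAtTwo : Prop :=
  ∀ ω₂ lam β γ : ℝ, 0 < ω₂ → 0 < lam → 0 < β → 0 < γ → Uniq ω₂ lam β γ →
    ∀ μ, IsFamily ω₂ lam β γ μ → ∀ T : ℝ, 0 < T → ∀ D : ℕ → ℝ, IsResponseSeq ω₂ lam β γ μ T D →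
      0 < D 2

/-- Real-analysis glue (PROVED): monotone from index 2 + `|D|` bounded + `D 2 > 0` ⇒ `D → k > 0`. -/
theorem real_glue (D : ℕ → ℝ) (hmono : ∀ N, 2 ≤ N → D N ≤ D (N + 1))
    (hbdd : BddAbove (Set.range fun N => |D N|)) (hpos : 0 < D 2) :
    ∃ k : ℝ, 0 < k ∧ Tendsto D atTop (𝓝 k) := by
  set E : ℕ → ℝ := fun n => D (n + 2) with hE
  have hstep : ∀ n : ℕ, E n ≤ E (n + 1) := by
    intro n
    have h := hmono (n + 2) (by omega)
    have heq : n + 1 + 2 = n + 2 + 1 := by ring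
    show D (n + 2) ≤ D (n + 1 + 2)
    rw [heq]
    exact h
  have hEmono : Monotone E := monotone_nat_of_le_succ hstep
  obtain ⟨B, hB⟩ := hbdd
  have hEbdd : BddAbove (Set.range E) := by
    refine ⟨B, ?_⟩
    rintro _ ⟨n, rfl⟩
    exact le_trans (le_abs_self _) (hB ⟨n + 2, rfl⟩)
  have hT : Tendsto E atTop (𝓝 (⨆ n, E n)) := tendsto_atTop_ciSup hEmono hEbdd
  refine ⟨⨆ n, E n, lt_of_lt_of_le hpos ?_, ?_⟩
  · have h0 : E 0 ≤ ⨆ n, E n := le_ciSup hEbdd 0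
    simpa [hE] using h0
  · exact (tendsto_add_atTop_iff_nat 2).mp hT

/-- KERNEL-CHECKED COMPOSITION (PROVED): (M) ∧ (P₂) ⇒ the crux, by name. The crux's own
hypothesis `BddAbove (range |D|)` is what turns monotonicity into convergence. -/
theorem boundedResponseConverges_of_monotone (hM : LengthMonotoneResponse)
    (hP : PositiveConductanceAtTwo) : BoundedResponseConverges := by
  intro ω₂ lam β γ h1 h2 h3 h4 hU μ hμ T hT D hD hbdd
  exact real_glue D (hM ω₂ lam β γ h1 h2 h3 h4 hU μ hμ T hT D hD) hbdd
    (hP ω₂ lam β γ h1 h2 h3 h4 hU μ hμ T hT D hD)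

/-- The SIGN behind (M) (PROVED): for positive coefficients, `D_N ≤ D_{N+1}` iff the secant of the
resistance-vs-bonds graph through `(N−1, R_N)` and `(N, R_{N+1})`, `R = (bonds)/D`, has a
NON-NEGATIVE intercept at zero length: `N·R_N − (N−1)·R_{N+1} ≥ 0` ("non-negative apparent
contact resistance"), equivalently marginal resistance ≤ mean resistance per bond. -/
theorem monotone_iff_intercept (n d₁ d₂ : ℝ) (hn : 1 < n) (h1 : 0 < d₁) (h2 : 0 < d₂) :
    d₁ ≤ d₂ ↔ 0 ≤ n * ((n - 1) / d₁) - (n - 1) * (n / d₂) := by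
  have hn0 : 0 < n := by linarith
  have hn1 : 0 < n - 1 := by linarith
  rw [sub_nonneg, div_eq_mul_inv, div_eq_mul_inv]
  constructor
  · intro h
    have : d₂⁻¹ ≤ d₁⁻¹ := by
      rw [inv_le_inv₀ h2 h1]; exact h
    nlinarith [mul_pos hn0 hn1]
  · intro h
    have hprod : 0 < (n - 1) * n := mul_pos hn1 hn0
    have : d₂⁻¹ ≤ d₁⁻¹ := by nlinarith
    rwa [inv_le_inv₀ h2 h1] at this

/-! ### § A Card `u-shaped-resistance-array` (and vocabulary shared with card C) -/

/-- (IH) INTERIOR HOMOGENEITY of the bond-resistance profile: deep inside every long chain every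
bond has the same linear-response resistance `r∞`, uniformly. -/
def InteriorHomogeneity : Prop :=
  ∀ ω₂ lam β γ : ℝ, 0 < ω₂ → 0 < lam → 0 < β → 0 < γ → Uniq ω₂ lam β γ →
    ∀ μ, IsFamily ω₂ lam β γ μ → ∀ T : ℝ, 0 < T → ∃ rinf : ℝ, ∀ ε : ℝ, 0 < ε →
      ∃ ℓ N₀ : ℕ, ∀ N : ℕ, N₀ ≤ N → ∀ (θ : Fin N → ℝ) (d : ℝ), IsProfile μ T N θ →
        Tendsto (fun δ : ℝ => (pinnedChain ω₂ lam β γ).totalCurrent (μ N (T + δ / 2) (T - δ / 2)) / δ)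
          (𝓝[≠] 0) (𝓝 d) →
        ∀ i : ℕ, ℓ ≤ i → i + ℓ + 2 ≤ N → |bondResistance N θ d i - rinf| ≤ ε

/-- (VCJ) VANISHING CONTACT JUMP: at fixed distance `ℓ` from the hot contact the first-order kinetic
temperature approaches the contact value as the chain grows (`θ_N(0) − θ_N(ℓ) → 0`; by the contact
identity `θ_N(0) = 1/2 − D_N/(γ(N−1)) → 1/2` under bounded response, so this says `θ_N(ℓ) → 1/2`:
the near-contact layer thermalises to ITS bath, the far bath is forgotten at the `O(1)` level). -/
def VanishingContactJump : Prop :=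
  ∀ ω₂ lam β γ : ℝ, 0 < ω₂ → 0 < lam → 0 < β → 0 < γ → Uniq ω₂ lam β γ →
    ∀ μ, IsFamily ω₂ lam β γ μ → ∀ T : ℝ, 0 < T → ∀ ℓ : ℕ, ∀ ε : ℝ, 0 < ε →
      ∃ N₀ : ℕ, ∀ (N : ℕ) (hN : N₀ + ℓ + 1 ≤ N) (θ : Fin N → ℝ), IsProfile μ T N θ →
        |θ ⟨0, by omega⟩ - θ ⟨ℓ, by omega⟩| ≤ ε

/-- CESÀRO GLUE (abstract real analysis; statement): given the ledger `R N = 2/γ + Σ_{i<N−1} r N i`,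
interior homogeneity of `r` with limit `rinf`, contact layers carrying a vanishing FRACTION of the
resistance, and bounded response `(N−1)/R N ≤ S`, the Kirchhoff means `(N−1)/R N` converge to
`1/rinf > 0`. (Boundary share: `Σ_{i<ℓ} r N i = (θ₀−θ_ℓ)·R N`, so VCJ is exactly "vanishing fraction".) -/
def CesaroGlueStatement : Prop :=
  ∀ (γ S : ℝ) (R : ℕ → ℝ) (r : ℕ → ℕ → ℝ) (rinf : ℝ), 0 < γ → 0 < S →
    (∀ N, 2 ≤ N → R N = 2 / γ + ∑ i ∈ Finset.range (N - 1), r N i) →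
    (∀ N, 2 ≤ N → 0 < R N ∧ ((N : ℝ) - 1) / R N ≤ S) →
    (∀ ε : ℝ, 0 < ε → ∃ ℓ N₀ : ℕ, ∀ N, N₀ ≤ N → ∀ i, ℓ ≤ i → i + ℓ + 2 ≤ N → |r N i - rinf| ≤ ε) →
    (∀ ℓ : ℕ, ∀ ε : ℝ, 0 < ε → ∃ N₀ : ℕ, ∀ N, N₀ ≤ N →
      |(∑ i ∈ Finset.range ℓ, r N i) + ∑ i ∈ Finset.Ico (N - 1 - ℓ) (N - 1), r N i| ≤ ε * R N) →
    0 < rinf ∧ Tendsto (fun N : ℕ => ((N : ℝ) - 1) / R N) atTop (𝓝 (1 / rinf))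

/-- (m0) NON-NEGATIVE BOND RESISTANCES: the first-order kinetic-temperature profile is non-increasing
from the hot to the cold contact at EVERY bond (the everywhere form of TransferKernelPositivity's
windowed `MonotoneProfile`, stmt-12008; local second law `j·Δθ ≥ 0`). -/
def NonnegBondResistance : Prop :=
  ∀ ω₂ lam β γ : ℝ, 0 < ω₂ → 0 < lam → 0 < β → 0 < γ → Uniq ω₂ lam β γ →
    ∀ μ, IsFamily ω₂ lam β γ μ → ∀ T : ℝ, 0 < T → ∀ (N : ℕ) (θ : Fin N → ℝ) (d : ℝ), IsProfile μ T N θ →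
      Tendsto (fun δ : ℝ => (pinnedChain ω₂ lam β γ).totalCurrent (μ N (T + δ / 2) (T - δ / 2)) / δ)
        (𝓝[≠] 0) (𝓝 d) → 0 < d → ∀ i : ℕ, i + 2 ≤ N → 0 ≤ bondResistance N θ d i

/-- (m1) U-SHAPED RESISTANCE PROFILE: from the hot contact to the middle bond the bond resistance is
non-increasing (by the exact left-right antisymmetry `θ_N(i) = −θ_N(N−1−i)`, equivalently non-decreasing
from the middle bond to the cold contact): the contact layers are resistive bumps relaxing monotonically
into the bulk; the temperature profile is convex on the hot half, concave on the cold half (the TP₃ rung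
of the sign-regularity ladder). Bond `i+1` is still in the hot half iff `2i + 4 ≤ N`. -/
def UShapedResistance : Prop :=
  ∀ ω₂ lam β γ : ℝ, 0 < ω₂ → 0 < lam → 0 < β → 0 < γ → Uniq ω₂ lam β γ →
    ∀ μ, IsFamily ω₂ lam β γ μ → ∀ T : ℝ, 0 < T → ∀ (N : ℕ) (θ : Fin N → ℝ) (d : ℝ), IsProfile μ T N θ →
      Tendsto (fun δ : ℝ => (pinnedChain ω₂ lam β γ).totalCurrent (μ N (T + δ / 2) (T - δ / 2)) / δ)
        (𝓝[≠] 0) (𝓝 d) → 0 < d →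
      ∀ i : ℕ, 2 * i + 4 ≤ N → bondResistance N θ d (i + 1) ≤ bondResistance N θ d i

/-- (m2) LENGTH-MONOTONICITY AT A FIXED BOND (domain monotonicity): for a bond `i` in the hot half,
lengthening the chain (the cold contact recedes) does not increase its resistance. -/
def LengthMonotoneBondResistance : Prop :=
  ∀ ω₂ lam β γ : ℝ, 0 < ω₂ → 0 < lam → 0 < β → 0 < γ → Uniq ω₂ lam β γ →
    ∀ μ, IsFamily ω₂ lam β γ μ → ∀ T : ℝ, 0 < T → ∀ N M : ℕ, N ≤ M →
      ∀ (θN : Fin N → ℝ) (dN : ℝ) (θM : Fin M → ℝ) (dM : ℝ),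
        IsProfile μ T N θN → IsProfile μ T M θM →
        Tendsto (fun δ : ℝ => (pinnedChain ω₂ lam β γ).totalCurrent (μ N (T + δ / 2) (T - δ / 2)) / δ)
          (𝓝[≠] 0) (𝓝 dN) →
        Tendsto (fun δ : ℝ => (pinnedChain ω₂ lam β γ).totalCurrent (μ M (T + δ / 2) (T - δ / 2)) / δ)
          (𝓝[≠] 0) (𝓝 dM) →
        0 < dN → 0 < dM → ∀ i : ℕ, 2 * i + 2 ≤ N → bondResistance M θM dM i ≤ bondResistance N θN dN i

/-- ORDER GLUE of card A (abstract, pure order theory; statement — the crux-plan stub, M-sized):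
with `R N = 2/γ + Σ_{i<N−1} r N i` (ledger), reflection symmetry `r N i = r N (N−2−i)`, the signs
(m0)–(m2) and bounded response `(N−1)/R N ≤ S`: `ζ_i := lim_N r N i` exists (monotone), is non-increasing
in `i` with limit `r∞ ≥ 0`; `limsup R_N/(N−1) ≤ ζ_ℓ` for every `ℓ` (U-shape) and
`liminf R_N/(N−1) ≥ r∞` (the middle bond dominates from below via (m2)), so `R_N/(N−1) → r∞`, and
bounded response forces `r∞ ≥ 1/S > 0`: `(N−1)/R_N → 1/r∞ ∈ (0, S]`. -/
def OrderGlueStatement : Prop :=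
  ∀ (γ S : ℝ) (R : ℕ → ℝ) (r : ℕ → ℕ → ℝ), 0 < γ → 0 < S →
    (∀ N, 2 ≤ N → R N = 2 / γ + ∑ i ∈ Finset.range (N - 1), r N i) →
    (∀ N, 2 ≤ N → 0 < R N ∧ ((N : ℝ) - 1) / R N ≤ S) →
    (∀ N i, i + 2 ≤ N → r N i = r N (N - 2 - i)) →
    (∀ N i, i + 2 ≤ N → 0 ≤ r N i) →
    (∀ N i, 2 * i + 4 ≤ N → r N (i + 1) ≤ r N i) →
    (∀ N M i, N ≤ M → 2 * i + 2 ≤ N → r M i ≤ r N i) →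
    ∃ k : ℝ, 0 < k ∧ Tendsto (fun N : ℕ => ((N : ℝ) - 1) / R N) atTop (𝓝 k)

/-- First piece of the order glue (PROVED): under (m2) + (m0) the limits `ζ_i = lim_N r N i` exist. -/
theorem zeta_exists (r : ℕ → ℕ → ℝ) (h0 : ∀ N i, i + 2 ≤ N → 0 ≤ r N i)
    (h2 : ∀ N M i, N ≤ M → 2 * i + 2 ≤ N → r M i ≤ r N i) (i : ℕ) :
    ∃ ζ : ℝ, Tendsto (fun N : ℕ => r (N + (2 * i + 2)) i) atTop (𝓝 ζ) := by
  set E : ℕ → ℝ := fun n => r (n + (2 * i + 2)) i with hE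
  have hanti : Antitone E := by
    refine antitone_nat_of_succ_le (fun n => ?_)
    show r (n + 1 + (2 * i + 2)) i ≤ r (n + (2 * i + 2)) i
    exact h2 _ _ i (by omega) (by omega)
  have hbdd : BddBelow (Set.range E) := ⟨0, by rintro _ ⟨n, rfl⟩; exact h0 _ _ (by omega)⟩
  exact ⟨⨅ n, E n, tendsto_atTop_ciInf hanti hbdd⟩

/-- iterating (m1): on the hot half the resistance is non-increasing from bond `ℓ` to bond `i`. -/
theorem chain_m1 (r : ℕ → ℕ → ℝ) (h1 : ∀ N i, 2 * i + 4 ≤ N → r N (i + 1) ≤ r N i)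
    (N ℓ : ℕ) : ∀ i, ℓ ≤ i → 2 * i + 2 ≤ N → r N i ≤ r N ℓ := by
  intro i
  induction i with
  | zero =>
    intro hli _
    have : ℓ = 0 := by omega
    subst this
    exact le_rfl
  | succ k ih =>
    intro hli hiN
    rcases Nat.eq_or_lt_of_le hli with h | h
    · rw [h]
    · have hk : ℓ ≤ k := by omega
      have hkN : 2 * k + 2 ≤ N := by omega
      exact le_trans (h1 N k (by omega)) (ih hk hkN)

/-- per-term upper bound used by the order glue. -/
theorem term_upper (r : ℕ → ℕ → ℝ)
    (hrefl : ∀ N i, i + 2 ≤ N → r N i = r N (N - 2 - i))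
    (h0 : ∀ N i, i + 2 ≤ N → 0 ≤ r N i)
    (h1 : ∀ N i, 2 * i + 4 ≤ N → r N (i + 1) ≤ r N i)
    (h2 : ∀ N M i, N ≤ M → 2 * i + 2 ≤ N → r M i ≤ r N i)
    (N ℓ i : ℕ) (hℓ : 2 * ℓ + 2 ≤ N) (hi : i + 2 ≤ N) :
    r N i ≤ r N ℓ + ((if i < ℓ then r (2 * i + 2) i else 0) +
      (if N - 2 - i < ℓ then r (2 * (N - 2 - i) + 2) (N - 2 - i) else 0)) := by
  have hc : ∀ j, 0 ≤ r (2 * j + 2) j := fun j => h0 _ _ (by omega)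
  have hot : ∀ j, 2 * j + 2 ≤ N → r N j ≤ r N ℓ + (if j < ℓ then r (2 * j + 2) j else 0) := by
    intro j hj
    by_cases hjl : j < ℓ
    · rw [if_pos hjl]
      have hA := h2 (2 * j + 2) N j hj le_rfl
      have hB : 0 ≤ r N ℓ := h0 N ℓ (by omega)
      linarith
    · rw [if_neg hjl]
      have hA := chain_m1 r h1 N ℓ j (by omega) hj
      linarith
  by_cases hhalf : 2 * i + 2 ≤ N
  · have hA := hot i hhalf
    have hnn : 0 ≤ (if N - 2 - i < ℓ then r (2 * (N - 2 - i) + 2) (N - 2 - i) else 0) := by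
      split_ifs
      · exact hc _
      · exact le_rfl
    linarith
  · have hj : 2 * (N - 2 - i) + 2 ≤ N := by omega
    have heq := hrefl N i hi
    have hA := hot (N - 2 - i) hj
    have hnn : 0 ≤ (if i < ℓ then r (2 * i + 2) i else 0) := by
      split_ifs
      · exact hc _
      · exact le_rfl
    rw [heq]
    linarith

/-- indicator sums are dominated by the full short sum. -/
theorem sum_indicator_le (n ℓ : ℕ) (g : ℕ → ℝ) (hg : ∀ i, 0 ≤ g i) :
    ∑ i ∈ Finset.range n, (if i < ℓ then g i else 0) ≤ ∑ i ∈ Finset.range ℓ, g i := by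
  rw [← Finset.sum_filter]
  apply Finset.sum_le_sum_of_subset_of_nonneg
  · intro i hi
    rw [Finset.mem_filter] at hi
    exact Finset.mem_range.mpr hi.2
  · intro i _ _
    exact hg i

/-- sum upper bound used by the order glue. -/
theorem sum_upper (r : ℕ → ℕ → ℝ)
    (hrefl : ∀ N i, i + 2 ≤ N → r N i = r N (N - 2 - i))
    (h0 : ∀ N i, i + 2 ≤ N → 0 ≤ r N i)
    (h1 : ∀ N i, 2 * i + 4 ≤ N → r N (i + 1) ≤ r N i)
    (h2 : ∀ N M i, N ≤ M → 2 * i + 2 ≤ N → r M i ≤ r N i)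
    (N ℓ : ℕ) (hℓ : 2 * ℓ + 2 ≤ N) :
    ∑ i ∈ Finset.range (N - 1), r N i ≤
      ((N : ℝ) - 1) * r N ℓ + 2 * ∑ i ∈ Finset.range ℓ, r (2 * i + 2) i := by
  have hN : 1 ≤ N := by omega
  have hc : ∀ j, 0 ≤ r (2 * j + 2) j := fun j => h0 _ _ (by omega)
  set g : ℕ → ℝ := fun j => r (2 * j + 2) j with hg
  set F : ℕ → ℝ := fun j => if j < ℓ then g j else 0 with hF
  have step1 : ∑ i ∈ Finset.range (N - 1), r N i ≤
      ∑ i ∈ Finset.range (N - 1), (r N ℓ + (F i + F (N - 1 - 1 - i))) := by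
    apply Finset.sum_le_sum
    intro i hi
    rw [Finset.mem_range] at hi
    have h := term_upper r hrefl h0 h1 h2 N ℓ i hℓ (by omega)
    have e : N - 2 - i = N - 1 - 1 - i := by omega
    simp only [hF, hg]
    rw [← e]
    exact h
  have step2 : ∑ i ∈ Finset.range (N - 1), (r N ℓ + (F i + F (N - 1 - 1 - i))) =
      ((N : ℝ) - 1) * r N ℓ + (∑ i ∈ Finset.range (N - 1), F i +
        ∑ i ∈ Finset.range (N - 1), F (N - 1 - 1 - i)) := by
    rw [Finset.sum_add_distrib, Finset.sum_add_distrib, Finset.sum_const, Finset.card_range,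
      nsmul_eq_mul, Nat.cast_sub hN, Nat.cast_one]
  have step3 : ∑ i ∈ Finset.range (N - 1), F (N - 1 - 1 - i) = ∑ i ∈ Finset.range (N - 1), F i :=
    Finset.sum_range_reflect F (N - 1)
  have step4 : ∑ i ∈ Finset.range (N - 1), F i ≤ ∑ i ∈ Finset.range ℓ, g i :=
    sum_indicator_le (N - 1) ℓ g hc
  rw [step2, step3] at step1
  linarith

/-- per-term lower bound: every bond resistance dominates `⨅_i ⨅_n r (n + (2i+2)) i`. -/
theorem term_lower (r : ℕ → ℕ → ℝ)
    (hrefl : ∀ N i, i + 2 ≤ N → r N i = r N (N - 2 - i))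
    (h0 : ∀ N i, i + 2 ≤ N → 0 ≤ r N i)
    (h2 : ∀ N M i, N ≤ M → 2 * i + 2 ≤ N → r M i ≤ r N i)
    (N i : ℕ) (hi : i + 2 ≤ N) :
    (⨅ j : ℕ, ⨅ n : ℕ, r (n + (2 * j + 2)) j) ≤ r N i := by
  have hz : ∀ j n, 0 ≤ r (n + (2 * j + 2)) j := fun j n => h0 _ _ (by omega)
  have hζbdd : ∀ j, BddBelow (Set.range fun n => r (n + (2 * j + 2)) j) := fun j =>
    ⟨0, by rintro _ ⟨n, rfl⟩; exact hz j n⟩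
  have hζnn : ∀ j, 0 ≤ ⨅ n : ℕ, r (n + (2 * j + 2)) j := fun j => le_ciInf (fun n => hz j n)
  have hrbdd : BddBelow (Set.range fun j => ⨅ n : ℕ, r (n + (2 * j + 2)) j) :=
    ⟨0, by rintro _ ⟨j, rfl⟩; exact hζnn j⟩
  have hot : ∀ j, 2 * j + 2 ≤ N → (⨅ j : ℕ, ⨅ n : ℕ, r (n + (2 * j + 2)) j) ≤ r N j := by
    intro j hj
    obtain ⟨n, hn⟩ : ∃ n, N = n + (2 * j + 2) := ⟨N - (2 * j + 2), by omega⟩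
    calc (⨅ j : ℕ, ⨅ n : ℕ, r (n + (2 * j + 2)) j) ≤ ⨅ n : ℕ, r (n + (2 * j + 2)) j := ciInf_le hrbdd j
      _ ≤ r (n + (2 * j + 2)) j := ciInf_le (hζbdd j) n
      _ = r N j := by rw [← hn]
  by_cases hhalf : 2 * i + 2 ≤ N
  · exact hot i hhalf
  · rw [hrefl N i hi]
    exact hot (N - 2 - i) (by omega)

/-- **ORDER GLUE of card A (PROVED).** -/
theorem orderGlue : OrderGlueStatement := by
  intro γ S R r hγ hS hled hbd hrefl h0 h1 h2
  -- the limit objects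
  have hz : ∀ j n, 0 ≤ r (n + (2 * j + 2)) j := fun j n => h0 _ _ (by omega)
  have hζbdd : ∀ j, BddBelow (Set.range fun n => r (n + (2 * j + 2)) j) := fun j =>
    ⟨0, by rintro _ ⟨n, rfl⟩; exact hz j n⟩
  set ζ : ℕ → ℝ := fun j => ⨅ n : ℕ, r (n + (2 * j + 2)) j with hζdef
  have hζnn : ∀ j, 0 ≤ ζ j := fun j => le_ciInf (fun n => hz j n)
  have hζle : ∀ j n, ζ j ≤ r (n + (2 * j + 2)) j := fun j n => ciInf_le (hζbdd j) n
  have hrbdd : BddBelow (Set.range ζ) := ⟨0, by rintro _ ⟨j, rfl⟩; exact hζnn j⟩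
  set rinf : ℝ := ⨅ j, ζ j with hrinfdef
  have hrinfle : ∀ j, rinf ≤ ζ j := fun j => ciInf_le hrbdd j
  -- lower bound on R N / (N-1)
  have hlowR : ∀ N, 2 ≤ N → rinf ≤ R N / ((N : ℝ) - 1) := by
    intro N hN
    have hN1 : (0 : ℝ) < (N : ℝ) - 1 := by
      have : (2 : ℝ) ≤ (N : ℝ) := by exact_mod_cast hN
      linarith
    have hsum : ((N : ℝ) - 1) * rinf ≤ ∑ i ∈ Finset.range (N - 1), r N i := by
      have h1N : 1 ≤ N := by omega
      calc ((N : ℝ) - 1) * rinf = ∑ i ∈ Finset.range (N - 1), rinf := by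
            rw [Finset.sum_const, Finset.card_range, nsmul_eq_mul, Nat.cast_sub h1N, Nat.cast_one]
        _ ≤ ∑ i ∈ Finset.range (N - 1), r N i := by
            apply Finset.sum_le_sum
            intro i hi
            rw [Finset.mem_range] at hi
            exact term_lower r hrefl h0 h2 N i (by omega)
    rw [le_div_iff₀ hN1, hled N hN]
    have : 0 < 2 / γ := div_pos two_pos hγ
    linarith
  -- upper bound: for every ε there are ℓ, N₀ with R N / (N-1) < rinf + ε beyond N₀
  have hupR : ∀ ε : ℝ, 0 < ε → ∃ N₀ : ℕ, ∀ N, N₀ ≤ N → R N / ((N : ℝ) - 1) < rinf + ε := by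
    intro ε hε
    obtain ⟨ℓ, hℓ⟩ : ∃ ℓ, ζ ℓ < rinf + ε / 4 := exists_lt_of_ciInf_lt (by linarith)
    obtain ⟨n₀, hn₀⟩ : ∃ n₀, r (n₀ + (2 * ℓ + 2)) ℓ < ζ ℓ + ε / 4 := exists_lt_of_ciInf_lt (by linarith)
    set Cℓ : ℝ := ∑ i ∈ Finset.range ℓ, r (2 * i + 2) i with hCℓ
    have hCℓnn : 0 ≤ Cℓ := Finset.sum_nonneg (fun i _ => h0 _ _ (by omega))
    -- choose N₀ so that (2/γ + 2 Cℓ)/(N-1) ≤ ε/4 as well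
    obtain ⟨K, hK⟩ : ∃ K : ℕ, (2 / γ + 2 * Cℓ) / (ε / 4) ≤ (K : ℝ) := exists_nat_ge _
    refine ⟨n₀ + (2 * ℓ + 2) + K + 2, ?_⟩
    intro N hN
    have hNnat : n₀ + (2 * ℓ + 2) ≤ N := by omega
    have hN1 : (0 : ℝ) < (N : ℝ) - 1 := by
      have : (2 : ℝ) ≤ (N : ℝ) := by exact_mod_cast (show 2 ≤ N by omega)
      linarith
    have hKN : (K : ℝ) + 1 ≤ (N : ℝ) - 1 := by
      have : ((K + 2 : ℕ) : ℝ) ≤ (N : ℝ) := by exact_mod_cast (show K + 2 ≤ N by omega)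
      push_cast at this
      linarith
    -- r N ℓ < rinf + ε/2
    have hrNℓ : r N ℓ < rinf + ε / 2 := by
      have hA : r N ℓ ≤ r (n₀ + (2 * ℓ + 2)) ℓ := h2 (n₀ + (2 * ℓ + 2)) N ℓ hNnat (by omega)
      have hB := hrinfle ℓ
      linarith
    have hsum := sum_upper r hrefl h0 h1 h2 N ℓ (by omega)
    have hR : R N = 2 / γ + ∑ i ∈ Finset.range (N - 1), r N i := hled N (by omega)
    -- tail term
    have htail : (2 / γ + 2 * Cℓ) ≤ (ε / 4) * ((N : ℝ) - 1) := by
      have hε4 : 0 < ε / 4 := by linarith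
      have := (div_le_iff₀ hε4).mp hK
      nlinarith
    rw [div_lt_iff₀ hN1, hR]
    have hrnn : 0 ≤ r N ℓ := h0 N ℓ (by omega)
    nlinarith
  -- convergence of R N / (N - 1) to rinf
  have hT : Tendsto (fun N : ℕ => R N / ((N : ℝ) - 1)) atTop (𝓝 rinf) := by
    rw [Metric.tendsto_atTop]
    intro ε hε
    obtain ⟨N₀, hN₀⟩ := hupR ε hε
    refine ⟨max N₀ 2, fun N hN => ?_⟩
    have hlo := hlowR N (le_trans (le_max_right _ _) hN)
    have hhi := hN₀ N (le_trans (le_max_left _ _) hN)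
    rw [Real.dist_eq, abs_lt]
    constructor <;> linarith
  -- positivity of rinf from bounded response
  have hSinv : ∀ N, 2 ≤ N → 1 / S ≤ R N / ((N : ℝ) - 1) := by
    intro N hN
    obtain ⟨hRpos, hDle⟩ := hbd N hN
    have hN1 : (0 : ℝ) < (N : ℝ) - 1 := by
      have : (2 : ℝ) ≤ (N : ℝ) := by exact_mod_cast hN
      linarith
    rw [div_le_iff₀ hRpos] at hDle
    rw [div_le_div_iff₀ hS hN1]
    linarith
  have hrinf_ge : 1 / S ≤ rinf :=
    ge_of_tendsto hT (Filter.eventually_atTop.mpr ⟨2, fun N hN => hSinv N hN⟩)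
  have hrinf_pos : 0 < rinf := lt_of_lt_of_le (div_pos one_pos hS) hrinf_ge
  -- invert
  refine ⟨rinf⁻¹, inv_pos.mpr hrinf_pos, ?_⟩
  have hinv := hT.inv₀ (ne_of_gt hrinf_pos)
  refine hinv.congr' ?_
  refine Filter.eventually_atTop.mpr ⟨2, fun N hN => ?_⟩
  show (R N / ((N : ℝ) - 1))⁻¹ = ((N : ℝ) - 1) / R N
  rw [inv_div]

/-! ### § C Card `resistance-screening-prefix-universality` -/

/-- resistance between bond `i+1` and the right contact, measured in the chain of length `N`:
`ρ^{right}_{i,N} = (θ_{i+1} − θ_{N−1})·(N−1)/d = Σ_{i<n<N−1} r_{n,N}`. -/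
def rightResistance (N : ℕ) (θ : Fin N → ℝ) (d : ℝ) (i : ℕ) : ℝ :=
  if h : i + 1 < N then (θ ⟨i + 1, h⟩ - θ ⟨N - 1, by omega⟩) * (((N : ℝ) - 1) / d) else 0

/-- (RS) RIGHT SCREENING: two chains `N ≤ M` driven from the same hot contact give the bond `i < N−1`
local resistances that differ by at most `C / ρ^{right}_{i,N}` — the far contact's influence on a
bond is screened by the resistance in between (Carleman / Weyl-disc shape: influence ≤ C/accumulated
dissipation). Vacuous at `lam = β = 0` (there `ρ^{right}` stays bounded, and indeed nothing is
forgotten). -/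
def RightScreening : Prop :=
  ∀ ω₂ lam β γ : ℝ, 0 < ω₂ → 0 < lam → 0 < β → 0 < γ → Uniq ω₂ lam β γ →
    ∀ μ, IsFamily ω₂ lam β γ μ → ∀ T : ℝ, 0 < T → ∃ C : ℝ, ∀ N M : ℕ, N ≤ M →
      ∀ (θN : Fin N → ℝ) (dN : ℝ) (θM : Fin M → ℝ) (dM : ℝ),
        IsProfile μ T N θN → IsProfile μ T M θM →
        Tendsto (fun δ : ℝ => (pinnedChain ω₂ lam β γ).totalCurrent (μ N (T + δ / 2) (T - δ / 2)) / δ)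
          (𝓝[≠] 0) (𝓝 dN) →
        Tendsto (fun δ : ℝ => (pinnedChain ω₂ lam β γ).totalCurrent (μ M (T + δ / 2) (T - δ / 2)) / δ)
          (𝓝[≠] 0) (𝓝 dM) →
        0 < dN → 0 < dM → ∀ i : ℕ, i + 2 ≤ N → 0 < rightResistance N θN dN i →
          |bondResistance N θN dN i - bondResistance M θM dM i| ≤ C / rightResistance N θN dN i

/-- de Bruijn–Erdős (1952) near-additivity lemma, two-sided form (statement; Literature-grade real
analysis, condensation form of `Σ φ(n)/n² < ∞`): a sequence with `|a(m+n) − a(m) − a(n)| ≤ φ(m+n)`,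
`φ ≥ 0` non-decreasing with `Σ_k φ(2^k)/2^k < ∞`, has `a(n)/n` convergent (to a real limit). With
`φ(n) = C·√n` this is the glue from PREFIX UNIVERSALITY (consequence of RS) to convergence of
`R_N/N`. -/
def NearAdditiveConverges : Prop :=
  ∀ (a φ : ℕ → ℝ), (∀ n, 0 ≤ φ n) → Monotone φ →
    Summable (fun k : ℕ => φ (2 ^ k) / (2 : ℝ) ^ k) →
    (∀ m n : ℕ, 1 ≤ m → 1 ≤ n → |a (m + n) - a m - a n| ≤ φ (m + n)) →
    ∃ L : ℝ, Tendsto (fun n : ℕ => a n / (n : ℝ)) atTop (𝓝 L)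

end Summit.AtomisticToContinuum.FouriersLaw.Cruxes.BoundedResponseConverges.Ideator3

end
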